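import Mathlib
import Summits.Ventures.HodgeRepro2.Tier7.Line3.CongruenceSubgroup

/-!
# Tier7/Line3/LevelTowerTopology — the level tower is OPEN in `GL₂` of an ultrametric normed field
(seat t7-x1, gen 3; the `hKopen` hypothesis of LevelFactorPositive p691647 discharged for the concrete tower)

LINE 3 (t7-plan-3), version (ii). LevelFactorPositive derives `b_γ₀` at the level place from three local facts, one of
which is that the levels `K_N` are OPEN subgroups (`hKopen : ∀ N, IsOpen (K N : Set G)`). For the concrete tower of
CongruenceSubgroup p694858 over a normed field `F` whose norm is ultrametric (`IsUltrametricDist F` — the completion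
`E_{v₁}` with `|·|_{v₁}`), this is a theorem: the absolute value `normAbv = ‖·‖` is non-archimedean
(`IsUltrametricDist.isNonarchimedean_norm`), the closed balls of an ultrametric space are open
(`IsUltrametricDist.isOpen_closedBall`), the entry maps of matrices are continuous, so
`{m | EntryLE r (m − 1)}` is a finite intersection of open sets (`isOpen_setOf_entryLE`), and the congruence subgroup is its
preimage under the continuous `Units.val : GL (Fin 2) F → Matrix` (`isOpen_congruenceSubgroup`, `isOpen_levelTower`).
`GL (Fin 2) F` is a topological group by Mathlib's instance for the units of a topological monoid
(`isTopologicalGroup_GL`), with the matrix topology from the normed field. What stays in words for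
LevelFactorPositive's remaining topological hypotheses: the COMPACTNESS of the two tori (`v₁` inert: `E¹_{v₁}` compact —
needs `ProperSpace F`, i.e. a local field, and the norm-compatibility of the involution) and the Haar measures (Mathlib's
`haarMeasure` on a compact group is finite and open-positive by instance once the tori are compact groups).
DICTIONARY (in words): `F = E_{v₁}` with `‖·‖ = |·|_{v₁}`. Nothing here is about (N), (P), the real `X`, or HC_CM;
§8(d): NO. Blind lane: Mathlib + the HodgeRepro2 prefix; no sorry; axioms ⊆ {propext, Classical.choice, Quot.sound}.
-/

namespace Summit.Ventures.HodgeRepro2.Tier7.Line3.LevelTowerTopology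

open Matrix Metric Summit.Ventures.HodgeRepro2.Tier7.Line3.CongruenceSubgroup

variable {F : Type*} [NormedField F]

/-- the absolute value `‖·‖` of a normed field, as an `AbsoluteValue`. -/
noncomputable def normAbv : AbsoluteValue F ℝ where
  toFun := norm
  map_mul' := norm_mul
  nonneg' := norm_nonneg
  eq_zero' := fun _ => norm_eq_zero
  add_le' := norm_add_le

/-- `normAbv x = ‖x‖`. -/
theorem normAbv_apply (x : F) : normAbv x = ‖x‖ := rfl

variable [IsUltrametricDist F]

/-- the norm of an ultrametric normed field is non-archimedean. -/
theorem isNonarchimedean_normAbv : IsNonarchimedean (normAbv : F → ℝ) := fun x y =>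
  IsUltrametricDist.norm_add_le_max x y

/-- `{m | EntryLE r (m − 1)}` is OPEN in the matrices for `r > 0` (closed balls are open in an ultrametric space). -/
theorem isOpen_setOf_entryLE {r : ℝ} (hr : 0 < r) :
    IsOpen {m : Matrix (Fin 2) (Fin 2) F | EntryLE normAbv r (m - 1)} := by
  have hset : {m : Matrix (Fin 2) (Fin 2) F | EntryLE normAbv r (m - 1)}
      = ⋂ i, ⋂ j, (fun m : Matrix (Fin 2) (Fin 2) F => (m - 1) i j) ⁻¹' closedBall (0 : F) r := by
    ext m
    simp [EntryLE, normAbv_apply, Set.mem_iInter, mem_closedBall, dist_zero_right]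
  rw [hset]
  refine isOpen_iInter_of_finite fun i => isOpen_iInter_of_finite fun j => ?_
  exact (IsUltrametricDist.isOpen_closedBall (0 : F) hr.ne').preimage
    ((continuous_id.sub continuous_const).matrix_elem i j)

/-- **the congruence subgroup is OPEN** in `GL (Fin 2) F` for `0 < r < 1`. -/
theorem isOpen_congruenceSubgroup {r : ℝ} (hr0 : 0 < r) (hr1 : r < 1) :
    IsOpen ((congruenceSubgroup normAbv isNonarchimedean_normAbv hr0.le hr1 : Subgroup (GL (Fin 2) F)) :
      Set (GL (Fin 2) F)) := by
  have hset : ((congruenceSubgroup normAbv isNonarchimedean_normAbv hr0.le hr1 : Subgroup (GL (Fin 2) F)) :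
      Set (GL (Fin 2) F)) = (Units.val : GL (Fin 2) F → Matrix (Fin 2) (Fin 2) F) ⁻¹'
        {m : Matrix (Fin 2) (Fin 2) F | EntryLE normAbv r (m - 1)} := rfl
  rw [hset]
  exact (isOpen_setOf_entryLE hr0).preimage Units.continuous_val

/-- the radius of the level tower is positive. -/
theorem radius_pos {q : ℝ} (hq : 1 < q) (N : ℕ) : 0 < q⁻¹ ^ (N + 1) :=
  pow_pos (inv_pos.2 (zero_lt_one.trans hq)) _

/-- **the level tower is OPEN**: the `hKopen` hypothesis of LevelFactorPositive for the concrete tower. -/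
theorem isOpen_levelTower {q : ℝ} (hq : 1 < q) (N : ℕ) :
    IsOpen ((levelTower normAbv isNonarchimedean_normAbv hq N : Subgroup (GL (Fin 2) F)) : Set (GL (Fin 2) F)) :=
  isOpen_congruenceSubgroup (radius_pos hq N) (radius_lt_one hq N)

omit [IsUltrametricDist F] in
/-- `GL (Fin 2) F` is a topological group (Mathlib: the units of a topological monoid). -/
theorem isTopologicalGroup_GL : IsTopologicalGroup (GL (Fin 2) F) := inferInstance

end Summit.Ventures.HodgeRepro2.Tier7.Line3.LevelTowerTopology
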